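import Summits.NavierStokesRegularity.FluidComputer.PalasekTowerEpisodesPinned

/-!
# Calibration of the re-pinned episode split: NO separable (prescribed-profile) stage — KERNEL

Cell `ns-blowup`, seat `ns-blowup-lean` (g2); companion of `PalasekTowerEpisodesPinned.lean`.
LABEL: E-C typing / BC7 calibration (KERNEL). WHAT THIS IS NOT: not Navier–Stokes evidence — a
theorem about the TYPED objects `Schedule.Pins` / `Stage`: the refuter's calibration junk cannot
inhabit a pinned stage.

Refuter g8's K-probe (HOME/refuter/KPROBE-EPISODES.md §A) inhabited the OLD `Stage … 1` by a
PRESCRIBED VELOCITY of separable form `u(t, x) = a(t) · V(x)` (a fixed profile `V` spun up by an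
amplitude `a ≥ 0`), pressure `p = 0`, force `f :=` the residual. The re-pin (`Schedule.Pins`:
impulse pin `Λ · c₄ Y_k · (τ_{k+1} - τ_k) ≤ c₁ Y_{k+1} - c₂ Y_k`, separation `θ c₂ Y_k ≤ c₁ Y_{k+1}`)
was designed so that this object FAILS; here that is PROVED, for the whole separable class:

* `Stage.false_of_separable` — under `S.Pins Λ θ` with `Λ > 1`, `θ > 1`, `ν ≥ 0`, no stage at a
  level `k + 1` has, on the slab `[0, τ_{k+1}]`, a velocity `u(t, x) = a(t) · V(x)` with `a`
  differentiable, `a ≥ 0` on the last growth interval, `V ∈ C²` attaining its maximal speed at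
  some point `x⋆`, and a pressure that does not push the fastest particle,
  `⟪∇p(t, x⋆), V(x⋆)⟫ ≥ 0` on `[τ_k, τ_{k+1}]` (`p = 0`: the K-probe's `S₀`; `p = a² π` with
  `(V·∇)V = -∇π`: every frozen steady-Euler / Gavrilov-type blob, since `⟪(V·∇)V, V⟫(x⋆) = 0`).
* `Stage.false_of_separable_zeroPressure` — the `p = 0` instance (literally the K-probe object,
  at any dilation `L`, any amplitude schedule).

Proof (max-point calculus, §1): at a maximum `x⋆` of `‖V‖`, Fermat gives `⟪DV(x⋆) w, V(x⋆)⟫ = 0`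
for every `w` (so the self-advection `a²(V·∇)V` is invisible along `V(x⋆)`), and the second-order
condition along each coordinate line gives `⟪ΔV(x⋆), V(x⋆)⟫ ≤ -|DV(x⋆)|² ≤ 0` (viscosity cannot
speed up the fastest particle). Pairing the momentum equation at `(t, x⋆)` with `V(x⋆)`:
`a′(t) ‖V(x⋆)‖ ≤ ‖f(t, x⋆)‖ ≤ c₄ Y_k` on `(τ_k, τ_{k+1})` (`Schedule.push_small`); the mean value
inequality and the floor / ceiling of the stage give
`c₁ Y_{k+1} - c₂ Y_k ≤ ‖V(x⋆)‖ (a(τ_{k+1}) - a(τ_k)) ≤ c₄ Y_k (τ_{k+1} - τ_k)`, i.e. JUMP ≤ IMPULSE,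
while the pins say `Λ · IMPULSE ≤ JUMP` and `JUMP ≥ (θ - 1) c₂ Y_k > 0` — impossible for `Λ > 1`.
No use is made of the strain floor or of confinement (they address the non-separable fakes).

References: S. Palasek, arXiv:2605.13827 §3.3 [cite: Palasek2026ElementaryModel, §3.3]; the
first/second-order conditions at an interior maximum are folklore calculus [folklore].
-/

noncomputable section

namespace Summit.NavierStokesRegularity.FluidComputer.PalasekTowerClayBridge

open Set MeasureTheory Filter Topology Function InnerProductSpace
open scoped ENNReal ContDiff NNReal Laplacian RealInnerProductSpace
open Literature.Analysis.FluidPDE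

/-! ## §1 Max-point calculus (folklore) -/

namespace MaxPoint

variable {E : Type*} [NormedAddCommGroup E] [InnerProductSpace ℝ E]
variable {F : Type*} [NormedAddCommGroup F] [InnerProductSpace ℝ F]

/-- Second-order condition at a local maximum of a real function: `h″(s₀) ≤ 0` (given `h′(s₀) = 0`,
continuity at `s₀`; `deriv` conventions, so no differentiability hypothesis is needed — if the
second derivative does not exist its junk value `0` satisfies the claim). [folklore] -/
theorem deriv_deriv_nonpos_of_isLocalMax {h : ℝ → ℝ} {s₀ : ℝ} (hmax : IsLocalMax h s₀)
    (hc : ContinuousAt h s₀) (hd : deriv h s₀ = 0) : deriv (deriv h) s₀ ≤ 0 := by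
  by_contra hpos
  have hpos' : 0 < deriv (deriv h) s₀ := lt_of_not_ge hpos
  have hmin : IsLocalMin h s₀ := isLocalMin_of_deriv_deriv_pos hpos' hd hc
  have hconst : ∀ᶠ s in 𝓝 s₀, h s = h s₀ := by
    filter_upwards [hmax, hmin] with s h1 h2
    exact le_antisymm h1 h2
  have hder : ∀ᶠ s in 𝓝 s₀, deriv h s = 0 := by
    obtain ⟨U, hU, hUo, hs₀⟩ := mem_nhds_iff.1 hconst
    filter_upwards [hUo.mem_nhds hs₀] with s hs
    have hloc : h =ᶠ[𝓝 s] fun _ => h s₀ := by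
      filter_upwards [hUo.mem_nhds hs] with r hr
      exact hU hr
    rw [hloc.deriv_eq]
    simp
  have h0 : deriv (deriv h) s₀ = 0 := by
    have hev : deriv h =ᶠ[𝓝 s₀] fun _ => (0 : ℝ) := hder
    rw [hev.deriv_eq]
    simp
  linarith

/-- Restriction of a `C²` field to a line: `d/ds V(x + s b) = DV(x + s b) b`. [folklore] -/
theorem hasDerivAt_line {V : E → F} (hV : ContDiff ℝ 2 V) (x b : E) (s : ℝ) :
    HasDerivAt (fun r => V (x + r • b)) (fderiv ℝ V (x + s • b) b) s := by
  have hℓ : HasDerivAt (fun r : ℝ => x + r • b) b s := by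
    simpa using ((hasDerivAt_id s).smul_const b).const_add x
  have hV1 : Differentiable ℝ V := hV.differentiable (by norm_num)
  exact (hV1 (x + s • b)).hasFDerivAt.comp_hasDerivAt s hℓ

/-- … and `d/ds DV(x + s b) b = D²V(x + s b) b b`. [folklore] -/
theorem hasDerivAt_line_fderiv {V : E → F} (hV : ContDiff ℝ 2 V) (x b : E) (s : ℝ) :
    HasDerivAt (fun r => fderiv ℝ V (x + r • b) b) (fderiv ℝ (fderiv ℝ V) (x + s • b) b b) s := by
  have hℓ : HasDerivAt (fun r : ℝ => x + r • b) b s := by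
    simpa using ((hasDerivAt_id s).smul_const b).const_add x
  have hV2 : Differentiable ℝ (fderiv ℝ V) :=
    (hV.fderiv_right (m := 1) (by norm_num)).differentiable (by norm_num)
  have h1 : HasDerivAt (fun r => fderiv ℝ V (x + r • b)) (fderiv ℝ (fderiv ℝ V) (x + s • b) b) s :=
    (hV2 (x + s • b)).hasFDerivAt.comp_hasDerivAt s hℓ
  exact ((ContinuousLinearMap.apply ℝ F b).hasFDerivAt).comp_hasDerivAt s h1

/-- **First- and second-order conditions at a maximum of the speed.** If `‖V y‖ ≤ ‖V x⋆‖` for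
all `y` and `V ∈ C²`, then for every direction `b`: `⟪V x⋆, DV(x⋆) b⟫ = 0` and
`⟪V x⋆, D²V(x⋆)[b, b]⟫ ≤ -‖DV(x⋆) b‖²` (apply the 1D conditions to `s ↦ ‖V(x⋆ + s b)‖²`). [folklore] -/
theorem max_point_conditions {V : E → F} {xs : E} (hV : ContDiff ℝ 2 V)
    (hmax : ∀ y, ‖V y‖ ≤ ‖V xs‖) (b : E) :
    ⟪V xs, fderiv ℝ V xs b⟫ = 0 ∧
      ⟪V xs, fderiv ℝ (fderiv ℝ V) xs b b⟫ ≤ -‖fderiv ℝ V xs b‖ ^ 2 := by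
  set φ : ℝ → F := fun s => V (xs + s • b) with hφ
  set φ' : ℝ → F := fun s => fderiv ℝ V (xs + s • b) b with hφ'
  set φ'' : ℝ → F := fun s => fderiv ℝ (fderiv ℝ V) (xs + s • b) b b with hφ''
  have hφd : ∀ s, HasDerivAt φ (φ' s) s := fun s => hasDerivAt_line hV xs b s
  have hφ'd : ∀ s, HasDerivAt φ' (φ'' s) s := fun s => hasDerivAt_line_fderiv hV xs b s
  set h : ℝ → ℝ := fun s => ‖φ s‖ ^ 2 with hh
  set h' : ℝ → ℝ := fun s => 2 * ⟪φ s, φ' s⟫ with hh'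
  have hhd : ∀ s, HasDerivAt h (h' s) s := fun s => (hφd s).norm_sq
  have hh'd : ∀ s, HasDerivAt h' (2 * (⟪φ' s, φ' s⟫ + ⟪φ s, φ'' s⟫)) s := fun s => by
    have := ((hφd s).inner ℝ (hφ'd s)).const_mul 2
    simpa [hh', add_comm] using this
  have hderiv_h : deriv h = h' := funext fun s => (hhd s).deriv
  have e0 : xs + (0 : ℝ) • b = xs := by simp
  have hmaxh : IsLocalMax h 0 := Filter.Eventually.of_forall fun s => by
    have h0 : 0 ≤ ‖φ s‖ := norm_nonneg _
    have := hmax (xs + s • b)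
    show ‖V (xs + s • b)‖ ^ 2 ≤ ‖V (xs + (0 : ℝ) • b)‖ ^ 2
    rw [e0]
    nlinarith
  have hd0' : h' 0 = 0 := hmaxh.hasDerivAt_eq_zero (hhd 0)
  have hd0 : deriv h 0 = 0 := by rw [(hhd 0).deriv]; exact hd0'
  have hsecond := deriv_deriv_nonpos_of_isLocalMax hmaxh (hhd 0).continuousAt hd0
  rw [hderiv_h, (hh'd 0).deriv] at hsecond
  have hfirst : ⟪V xs, fderiv ℝ V xs b⟫ = 0 := by
    have : 2 * ⟪φ 0, φ' 0⟫ = 0 := hd0'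
    simp only [hφ, hφ', e0] at this
    linarith
  refine ⟨hfirst, ?_⟩
  have hsq : ⟪φ' 0, φ' 0⟫ = ‖φ' 0‖ ^ 2 := real_inner_self_eq_norm_sq _
  have : ⟪φ 0, φ'' 0⟫ ≤ -‖φ' 0‖ ^ 2 := by nlinarith
  simpa [hφ, hφ', hφ'', e0] using this

/-- At a maximum of the speed the derivative is orthogonal to the velocity: `⟪DV(x⋆) w, V x⋆⟫ = 0`
— in particular the self-advection `(V·∇)V (x⋆) = DV(x⋆) (V x⋆)` is. [folklore] -/
theorem inner_fderiv_apply_self_eq_zero {V : E → F} {xs : E} (hV : ContDiff ℝ 2 V)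
    (hmax : ∀ y, ‖V y‖ ≤ ‖V xs‖) (w : E) : ⟪fderiv ℝ V xs w, V xs⟫ = 0 := by
  rw [real_inner_comm]
  exact (max_point_conditions hV hmax w).1

/-- At a maximum of the speed the Laplacian points against the velocity: `⟪ΔV(x⋆), V x⋆⟫ ≤ 0`
(`E` finite-dimensional; sum the second-order conditions over an orthonormal basis). [folklore] -/
theorem inner_laplacian_self_nonpos [FiniteDimensional ℝ E] {V : E → F} {xs : E}
    (hV : ContDiff ℝ 2 V) (hmax : ∀ y, ‖V y‖ ≤ ‖V xs‖) :
    ⟪(Δ V) xs, V xs⟫ ≤ 0 := by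
  rw [laplacian_eq_iteratedFDeriv_stdOrthonormalBasis V]
  simp only
  rw [sum_inner]
  refine Finset.sum_nonpos fun i _ => ?_
  rw [iteratedFDeriv_two_apply, real_inner_comm]
  have h := (max_point_conditions hV hmax (stdOrthonormalBasis ℝ E i)).2
  have h2 : 0 ≤ ‖fderiv ℝ V xs (stdOrthonormalBasis ℝ E i)‖ ^ 2 := sq_nonneg _
  simpa using h.trans (by linarith)

end MaxPoint

/-! ## §2 No separable stage under the pins -/

namespace Stage

variable {ν : ℝ} {R : TowerRates} {S : Schedule R} {m : Margins R} {k : ℕ} {Λ θ : ℝ}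

/-- **No separable (prescribed-profile) stage under the pins.** See the module docstring: a
stage at level `k+1` of a schedule with `S.Pins Λ θ`, `Λ > 1`, `θ > 1` (`ν ≥ 0`) cannot have a
velocity `u(t, x) = a(t) · V(x)` on `[0, τ_{k+1}]` with `a` differentiable, `a ≥ 0` on
`[τ_k, τ_{k+1}]`, `V ∈ C²` with a point `x⋆` of maximal speed, and `⟪∇p(t, x⋆), V x⋆⟫ ≥ 0` on
`[τ_k, τ_{k+1}]`. (The registered margin `m`, the strain floor and confinement are not used.)
[cite: Palasek2026ElementaryModel, §3.3] -/
theorem false_of_separable (hP : S.Pins Λ θ) (hΛ : 1 < Λ) (hθ : 1 < θ) (hν : 0 ≤ ν)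
    (s : Stage ν R S m (k + 1)) (a : ℝ → ℝ)
    (V : EuclideanSpace ℝ (Fin 3) → EuclideanSpace ℝ (Fin 3)) (xs : EuclideanSpace ℝ (Fin 3))
    (hu : ∀ t ∈ Icc 0 (S.τ (k + 1)), ∀ x, s.u t x = a t • V x)
    (ha : DifferentiableOn ℝ a (Icc 0 (S.τ (k + 1))))
    (ha0 : ∀ t ∈ Icc (S.τ k) (S.τ (k + 1)), 0 ≤ a t)
    (hV : ContDiff ℝ 2 V) (hmax : ∀ y, ‖V y‖ ≤ ‖V xs‖)
    (hp : ∀ t ∈ Icc (S.τ k) (S.τ (k + 1)), 0 ≤ ⟪gradient (s.p t) xs, V xs⟫) : False := by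
  have hτk : S.τ k < S.τ (k + 1) := S.τ_lt_succ k
  have hτk0 : 0 < S.τ k := S.τ_pos k
  have hY1 : 0 < R.Y (k + 1) := Real.rpow_pos_of_pos (R.N_pos _) _
  have hYk : 0 < R.Y k := Real.rpow_pos_of_pos (R.N_pos _) _
  have hc₁ : 0 < S.c₁ := S.c₁_pos
  have hc₂ : 0 < S.c₂ := s.c₂_pos
  have hτ1I : S.τ (k + 1) ∈ Icc 0 (S.τ (k + 1)) := ⟨(S.τ_pos _).le, le_rfl⟩
  have hτ0I : S.τ k ∈ Icc 0 (S.τ (k + 1)) := ⟨hτk0.le, hτk.le⟩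
  have ha1 : 0 ≤ a (S.τ (k + 1)) := ha0 _ ⟨hτk.le, le_rfl⟩
  have ha0' : 0 ≤ a (S.τ k) := ha0 _ ⟨le_rfl, hτk.le⟩
  -- the speed of the separable field
  have hspeed : ∀ t ∈ Icc 0 (S.τ (k + 1)), 0 ≤ a t → ∀ x, ‖s.u t x‖ = a t * ‖V x‖ := by
    intro t ht hat x
    rw [hu t ht x, norm_smul, Real.norm_eq_abs, abs_of_nonneg hat]
  -- `‖V xs‖ > 0`: otherwise `V = 0`, `u(τ_{k+1}) = 0`, contradicting the floor
  obtain ⟨x₁, -, hfl⟩ := s.floor (k + 1) le_rfl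
  rw [hspeed _ hτ1I ha1] at hfl
  have hMpos : 0 < ‖V xs‖ := by
    by_contra hM0
    have hM0' : ‖V xs‖ = 0 := le_antisymm (not_lt.1 hM0) (norm_nonneg _)
    have hV1 : ‖V x₁‖ = 0 :=
      le_antisymm (by have h := hmax x₁; rwa [hM0'] at h) (norm_nonneg _)
    rw [hV1, mul_zero] at hfl
    nlinarith
  -- the key pointwise inequality: `a′(t) · ‖V xs‖ ≤ c₄ Y_k` inside the growth interval
  have hkey : ∀ t ∈ Ioo (S.τ k) (S.τ (k + 1)), deriv a t * ‖V xs‖ ≤ S.c₄ * R.Y k := by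
    intro t ht
    have htI : t ∈ Icc 0 (S.τ (k + 1)) := ⟨(hτk0.trans ht.1).le, ht.2.le⟩
    have htk : t ∈ Icc (S.τ k) (S.τ (k + 1)) := ⟨ht.1.le, ht.2.le⟩
    have hInhds : Icc 0 (S.τ (k + 1)) ∈ 𝓝 t := Icc_mem_nhds (hτk0.trans ht.1) ht.2
    have hat : DifferentiableAt ℝ a t := (ha t htI).differentiableAt hInhds
    have hsl : s.u t = a t • V := funext (hu t htI)
    -- time derivative of the separable field
    have htd : timeDerivWithin (Icc 0 (S.τ (k + 1))) s.u t xs = deriv a t • V xs := by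
      rw [timeDerivWithin_apply]
      have hc : derivWithin (fun r => s.u r xs) (Icc 0 (S.τ (k + 1))) t =
          derivWithin (fun r => a r • V xs) (Icc 0 (S.τ (k + 1))) t :=
        derivWithin_congr (fun r hr => hu r hr xs) (hu t htI xs)
      rw [hc, derivWithin_of_mem_nhds hInhds, deriv_smul_const hat]
    -- self-advection is orthogonal to `V xs`
    have hconv : ⟪convect (s.u t) (s.u t) xs, V xs⟫ = 0 := by
      rw [convect_apply, hsl, fderiv_const_smul (hV.differentiable (by norm_num) xs)]
      show ⟪a t • fderiv ℝ V xs (a t • V xs), V xs⟫ = 0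
      rw [map_smul, inner_smul_left, inner_smul_left,
        MaxPoint.inner_fderiv_apply_self_eq_zero hV hmax]
      simp
    -- viscosity does not speed up the fastest particle
    have hvisc : ν * ⟪(Δ (s.u t)) xs, V xs⟫ ≤ 0 := by
      rw [hsl, laplacian_smul (a t) hV.contDiffAt, inner_smul_left]
      simp only [conj_trivial]
      have hq := MaxPoint.inner_laplacian_self_nonpos hV hmax
      have h1 : 0 ≤ ν * a t := mul_nonneg hν (ha0 t htk)
      nlinarith
    -- the force is host-small there
    have hf : ⟪S.f t xs, V xs⟫ ≤ S.c₄ * R.Y k * ‖V xs‖ :=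
      (real_inner_le_norm _ _).trans
        (mul_le_mul_of_nonneg_right (S.push_small k t htk xs) (norm_nonneg _))
    have hpt := hp t htk
    -- pair the momentum equation with `V xs`
    have hmom := congrArg (fun w => ⟪w, V xs⟫) (s.classical.momentum t htI xs)
    simp only [inner_add_left, inner_sub_left, htd, hconv, add_zero, inner_smul_left,
      conj_trivial, real_inner_self_eq_norm_sq] at hmom
    -- `hmom : deriv a t * ‖V xs‖ ^ 2 = ⟪ν • Δ u, V⟫ - ⟪∇p, V⟫ + ⟪f, V⟫`
    have h2 : deriv a t * ‖V xs‖ ^ 2 ≤ S.c₄ * R.Y k * ‖V xs‖ := by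
      rw [hmom]
      linarith
    have h3 : deriv a t * ‖V xs‖ * ‖V xs‖ ≤ S.c₄ * R.Y k * ‖V xs‖ := by nlinarith
    exact le_of_mul_le_mul_right h3 hMpos
  -- mean value inequality on `[τ_k, τ_{k+1}]`
  have hcont : ContinuousOn a (Icc (S.τ k) (S.τ (k + 1))) :=
    ha.continuousOn.mono (Icc_subset_Icc hτk0.le le_rfl)
  have hdiff : DifferentiableOn ℝ a (interior (Icc (S.τ k) (S.τ (k + 1)))) := by
    rw [interior_Icc]
    intro t ht
    have htI : t ∈ Icc 0 (S.τ (k + 1)) := ⟨(hτk0.trans ht.1).le, ht.2.le⟩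
    exact ((ha t htI).differentiableAt
      (Icc_mem_nhds (hτk0.trans ht.1) ht.2)).differentiableWithinAt
  have hder : ∀ t ∈ interior (Icc (S.τ k) (S.τ (k + 1))), deriv a t ≤ S.c₄ * R.Y k / ‖V xs‖ := by
    rw [interior_Icc]
    intro t ht
    rw [le_div_iff₀ hMpos]
    exact hkey t ht
  have hmvt := (convex_Icc (S.τ k) (S.τ (k + 1))).image_sub_le_mul_sub_of_deriv_le hcont hdiff
    hder (S.τ k) (left_mem_Icc.2 hτk.le) (S.τ (k + 1)) (right_mem_Icc.2 hτk.le) hτk.le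
  -- floor at `τ_{k+1}` and ceiling at `τ_k`
  have hceil := s.ceiling k (Nat.le_succ k) (S.τ k) ⟨hτk0.le, le_rfl⟩ xs
  rw [hspeed _ hτ0I ha0'] at hceil
  have hfl' : S.c₁ * R.Y (k + 1) ≤ a (S.τ (k + 1)) * ‖V xs‖ :=
    hfl.trans (mul_le_mul_of_nonneg_left (hmax x₁) ha1)
  -- JUMP ≤ IMPULSE
  have hJ : S.c₁ * R.Y (k + 1) - S.c₂ * R.Y k ≤ S.c₄ * R.Y k * (S.τ (k + 1) - S.τ k) := by
    have h1 : (a (S.τ (k + 1)) - a (S.τ k)) * ‖V xs‖ ≤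
        S.c₄ * R.Y k / ‖V xs‖ * (S.τ (k + 1) - S.τ k) * ‖V xs‖ :=
      mul_le_mul_of_nonneg_right hmvt hMpos.le
    have h2 : S.c₄ * R.Y k / ‖V xs‖ * (S.τ (k + 1) - S.τ k) * ‖V xs‖ =
        S.c₄ * R.Y k * (S.τ (k + 1) - S.τ k) := by
      field_simp
    rw [h2] at h1
    calc S.c₁ * R.Y (k + 1) - S.c₂ * R.Y k
        ≤ a (S.τ (k + 1)) * ‖V xs‖ - a (S.τ k) * ‖V xs‖ := by linarith
      _ = (a (S.τ (k + 1)) - a (S.τ k)) * ‖V xs‖ := by ring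
      _ ≤ S.c₄ * R.Y k * (S.τ (k + 1) - S.τ k) := h1
  -- the pins: Λ · IMPULSE ≤ JUMP and JUMP ≥ (θ - 1) c₂ Y_k > 0
  have himp := hP.impulse k
  have hsep := hP.sep k
  have hc₂Y : 0 < S.c₂ * R.Y k := mul_pos hc₂ hYk
  have hpos : 0 < S.c₁ * R.Y (k + 1) - S.c₂ * R.Y k := by nlinarith
  have hI0 : 0 ≤ S.c₄ * R.Y k * (S.τ (k + 1) - S.τ k) := S.impulse_nonneg k
  nlinarith

/-- **The K-probe's calibration object `S₀` fails every pinned stage** — the `p = 0` instance of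
`false_of_separable` (prescribed velocity `a(t)·V(x)` of any profile with a maximal speed, any
amplitude schedule `a ≥ 0`, zero pressure, force := residual). [cite: Palasek2026ElementaryModel, §3.3] -/
theorem false_of_separable_zeroPressure (hP : S.Pins Λ θ) (hΛ : 1 < Λ) (hθ : 1 < θ) (hν : 0 ≤ ν)
    (s : Stage ν R S m (k + 1)) (a : ℝ → ℝ)
    (V : EuclideanSpace ℝ (Fin 3) → EuclideanSpace ℝ (Fin 3)) (xs : EuclideanSpace ℝ (Fin 3))
    (hu : ∀ t ∈ Icc 0 (S.τ (k + 1)), ∀ x, s.u t x = a t • V x)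
    (hp0 : ∀ t ∈ Icc (S.τ k) (S.τ (k + 1)), s.p t = 0)
    (ha : DifferentiableOn ℝ a (Icc 0 (S.τ (k + 1))))
    (ha0 : ∀ t ∈ Icc (S.τ k) (S.τ (k + 1)), 0 ≤ a t)
    (hV : ContDiff ℝ 2 V) (hmax : ∀ y, ‖V y‖ ≤ ‖V xs‖) : False := by
  refine false_of_separable hP hΛ hθ hν s a V xs hu ha ha0 hV hmax fun t ht => ?_
  rw [hp0 t ht]
  simp [gradient, Pi.zero_def]

end Stage

end Summit.NavierStokesRegularity.FluidComputer.PalasekTowerClayBridge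

end
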